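import Literature.Analysis.FluidPDE.PassiveScalarFourier
import Literature.Analysis.FluidPDE.PassiveScalarDiagForcedClass
import HarnessLib

/-!
# Fourier modes of weak passive scalars with constant diagonal diffusion (and a source)

Analysis/FluidPDE proof-support file (everything proved; no new definitions). Twin, for the
diagonal-diffusion classes `Torus.IsWeakScalarTransportDiagForcedOn T a κ u s θ₀ θ`
(`∂ₜθ + u·∇θ = κ ∑ᵢ aᵢ ∂ᵢ∂ᵢθ + s` on `T^d × [0,T)`, `PassiveScalarDiagForced`) and
`Torus.IsWeakScalarTransportDiagOn` (`s = 0`, `AcceleratingDissipationEnhancement`), of the modewise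
integral equation of `PassiveScalarFourier` (`Torus.IsWeakScalarTransportOn.ae_mFourierCoeff_eq`,
isotropic `κΔ`): a weak solution is tested against the separated one-mode test functions
`ψ(t, x) = η(t) Re (z e_{-k}(x))`, on which the diagonal operator acts by the symbol
`∑ᵢ aᵢ ∂ᵢ∂ᵢ Re (z e_{-k}) = Re (-4π² (∑ᵢ aᵢ kᵢ²) z e_{-k})`, and the a.e. du Bois-Reymond lemma with
datum (`FunctionSpaces.ae_eq_add_setIntegral_of_forall_test`) turns the distributional ODE into

  `𝓕θ(t)(k) = 𝓕θ₀(k) + ∫_{(0,t]} ( -4π²κ (∑ᵢ aᵢ kᵢ²) 𝓕θ(τ)(k) - ∑ⱼ 2πi kⱼ 𝓕(θ uⱼ)(τ)(k) + 𝓕s(τ)(k) ) dτ`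

for every `k ∈ ℤ^d` and a.e. `t ∈ (0,T)` (`IsWeakScalarTransportDiagForcedOn.ae_mFourierCoeff_eq`;
homogeneous form `IsWeakScalarTransportDiagOn.ae_mFourierCoeff_eq`). Only the definition of a weak
solution, `θ₀ ∈ L¹` and the standing class conditions are used (no bound on `u` beyond `uθ ∈ L¹`),
so the identity also covers `κ = 0` and degenerate coefficients.

Contents: §1 the diagonal operator on one-mode test functions (`sum_mul_partialDeriv_partialDeriv_re_oneMode`,
`integral_mul_diagFlux_oneMode`); §2 the weak formulation tested with `η(t) g(x)` (private; the
solution-class API — joint measurability, `θ ∈ L¹_{t,x}`, `‖u‖θ ∈ L¹`, `s ∈ L¹`, the weak identity in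
product-measure form — is `PassiveScalarDiagForcedClass`, prover seat ad-prover-3 of the cell);
§3 the Fourier modes (`integrableOn_mFourierCoeff`, `…_mul_velocity`, `…_source`, the modewise identity).
Consumer: `PassiveScalarDiagUniqueness` (uniqueness in `L^∞_t L²_x` for bounded drifts by a
modewise energy bound and Grönwall, cell `ad-ideate`, layer (P2) T1′).

## Mathlib / tree search

Tree: `PassiveScalarFourier` (one-mode calculus `Torus.partialDeriv_re_oneMode`,
`Torus.inner_gradient_re_oneMode`, `Torus.integral_mul_re_oneMode`, `Torus.isSpaceTimeTest_mul`,
`Torus.timeDeriv_mul`; the isotropic modewise identity), `PassiveScalarForcedClass` /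
`PassiveScalarSteadyTest` (the sourced isotropic class), `PassiveScalarDiagForced` (the notion,
`isWeakScalarTransportDiagForcedOn_zero_iff`), `PassiveScalarDiagForcedClass` (solution-class API of
the diagonal notion), `DuBoisReymondAE`. `lean search 'mFourierCoeff' FluidPDE/PassiveScalarDiag*`: no
modewise form of the diagonal weak formulation exists (2026-08-27).

## References

* R. J. DiPerna, P.-L. Lions, Invent. Math. 98 (1989), §II.1, (12)–(14). [`DiPernaLions1989`]
* T. D. Drivas, T. M. Elgindi, G. Iyer, I.-J. Jeong, ARMA 243 (2022), (1.1). [`DEIJ2022`]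
* L. Grafakos, *Classical Fourier Analysis*, 3rd ed., GTM 249 (2014), Prop. 3.2.6 (8). [`Grafakos2014`]
-/

noncomputable section

open MeasureTheory TopologicalSpace Set Function Filter Topology UnitAddTorus Complex
open scoped ENNReal NNReal InnerProductSpace ComplexConjugate ContDiff

namespace Literature.Analysis.FluidPDE

namespace Torus

variable {d : Type*} [Fintype d]

/-! ## §1 The diagonal operator on one-mode test functions -/

section OneMode

variable [DecidableEq d]

omit [Fintype d] in
/-- `∂ᵢ (c f) = c ∂ᵢ f` for real functions on `T^d` (no differentiability needed). [folklore] -/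
private theorem partialDeriv_const_mul' (c : ℝ) (f : UnitAddTorus d → ℝ) (i : d) :
    FunctionSpaces.Torus.partialDeriv i (fun y => c * f y) = fun x => c * FunctionSpaces.Torus.partialDeriv i f x := by
  funext x
  simp only [FunctionSpaces.Torus.partialDeriv, FunctionSpaces.Torus.lineDeriv, deriv_const_mul_field']

omit [Fintype d] in
/-- `∂ᵢ∂ᵢ (c f) = c ∂ᵢ∂ᵢ f` for real functions on `T^d`. [folklore] -/
private theorem partialDeriv_partialDeriv_const_mul (c : ℝ) (f : UnitAddTorus d → ℝ) (i : d) (x : UnitAddTorus d) :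
    FunctionSpaces.Torus.partialDeriv i (FunctionSpaces.Torus.partialDeriv i (fun y => c * f y)) x =
      c * FunctionSpaces.Torus.partialDeriv i (FunctionSpaces.Torus.partialDeriv i f) x := by
  rw [partialDeriv_const_mul', partialDeriv_const_mul']

/-- **The diagonal operator on the one-mode test function**:
`∑ᵢ aᵢ ∂ᵢ∂ᵢ Re (z e_{-k}) = Re (-4π² (∑ᵢ aᵢ kᵢ²) z e_{-k})` (Grafakos 2014, Prop. 3.2.6 (8):
`∂ⱼ e_m = 2πi mⱼ e_m`, twice). [cite: Grafakos2014, Prop. 3.2.6 (8)] -/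
theorem sum_mul_partialDeriv_partialDeriv_re_oneMode (a : d → ℝ) (k : d → ℤ) (z : ℂ) (x : UnitAddTorus d) :
    ∑ i, a i * FunctionSpaces.Torus.partialDeriv i (FunctionSpaces.Torus.partialDeriv i
      (fun y : UnitAddTorus d => (FunctionSpaces.Torus.trigPoly {-k} (fun _ => z) y).re)) x =
      (-((4 * Real.pi ^ 2 * ∑ i, a i * (k i : ℝ) ^ 2 : ℝ) : ℂ) * z * mFourier (-k) x).re := by
  have h : ∀ j : d, FunctionSpaces.Torus.partialDeriv j (FunctionSpaces.Torus.partialDeriv j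
      (fun y : UnitAddTorus d => (FunctionSpaces.Torus.trigPoly {-k} (fun _ => z) y).re)) x =
      ((2 * Real.pi * I * (k j)) ^ 2 * z * mFourier (-k) x).re := by
    intro j
    have e : FunctionSpaces.Torus.partialDeriv j (fun y : UnitAddTorus d => (FunctionSpaces.Torus.trigPoly {-k} (fun _ => z) y).re) =
        fun y : UnitAddTorus d => (FunctionSpaces.Torus.trigPoly {-k} (fun k' => (2 * Real.pi * I * (k' j)) • z) y).re :=
      funext fun y => FunctionSpaces.Torus.partialDeriv_re_trigPoly _ _ _ _
    rw [e, FunctionSpaces.Torus.partialDeriv_re_trigPoly, FunctionSpaces.Torus.trigPoly_apply, Finset.sum_singleton]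
    simp only [Pi.neg_apply, Int.cast_neg, smul_eq_mul]
    congr 1
    ring
  simp_rw [h]
  simp_rw [real_mul_re_mul]
  rw [← Complex.re_sum]
  congr 1
  rw [← Finset.sum_mul]
  simp_rw [← mul_assoc]
  rw [← Finset.sum_mul]
  congr 2
  push_cast
  rw [Finset.mul_sum, ← Finset.sum_neg_distrib]
  refine Finset.sum_congr rfl fun i _ => ?_
  linear_combination ((a i : ℂ)) * ((2 : ℂ) * Real.pi * (k i : ℂ)) ^ 2 * I_mul_I

/-- **The spatial pairings of a slice with the one-mode test function, diagonal diffusion.** If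
`θ t` and the fluxes `θ t · uⱼ t` are integrable, then with `χ = Re (z e_{-k})`,
`∫ θ(t) (⟪u(t), ∇χ⟫ + κ ∑ᵢ aᵢ ∂ᵢ∂ᵢχ) = Re (z (-4π²κ (∑ᵢ aᵢkᵢ²) 𝓕θ(t)(k) - ∑ⱼ 2πi kⱼ 𝓕(θ uⱼ)(t)(k)))`.
[cite: Grafakos2014, Prop. 3.2.6 (8)] -/
theorem integral_mul_diagFlux_oneMode {a : d → ℝ} {κ : ℝ} {u : ℝ → UnitAddTorus d → EuclideanSpace ℝ d}
    {θ : ℝ → UnitAddTorus d → ℝ} {t : ℝ} (hθt : Integrable (θ t) volume)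
    (hju : ∀ j, Integrable (fun x => θ t x * u t x j) volume) (k : d → ℤ) (z : ℂ) :
    ∫ x, θ t x * (⟪u t x, FunctionSpaces.Torus.gradient (fun y : UnitAddTorus d => (FunctionSpaces.Torus.trigPoly {-k} (fun _ => z) y).re) x⟫_ℝ +
      κ * ∑ i, a i * FunctionSpaces.Torus.partialDeriv i (FunctionSpaces.Torus.partialDeriv i
        (fun y : UnitAddTorus d => (FunctionSpaces.Torus.trigPoly {-k} (fun _ => z) y).re)) x) =
      (z * (-(((4 * Real.pi ^ 2 * κ * ∑ i, a i * (k i : ℝ) ^ 2 : ℝ)) : ℂ) * mFourierCoeff (fun x => (θ t x : ℂ)) k -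
        ∑ j, (2 * Real.pi * I * (k j)) *
          mFourierCoeff (fun x => ((θ t x * u t x j : ℝ) : ℂ)) k)).re := by
  -- pointwise expansion of the integrand
  have hpt : ∀ x, θ t x * (⟪u t x, FunctionSpaces.Torus.gradient (fun y : UnitAddTorus d => (FunctionSpaces.Torus.trigPoly {-k} (fun _ => z) y).re) x⟫_ℝ +
      κ * ∑ i, a i * FunctionSpaces.Torus.partialDeriv i (FunctionSpaces.Torus.partialDeriv i
        (fun y : UnitAddTorus d => (FunctionSpaces.Torus.trigPoly {-k} (fun _ => z) y).re)) x) =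
      (∑ j, (θ t x * u t x j) * ((-(2 * Real.pi * I * (k j)) * z) * mFourier (-k) x).re) +
        θ t x * (((κ : ℂ) * (-((4 * Real.pi ^ 2 * ∑ i, a i * (k i : ℝ) ^ 2 : ℝ) : ℂ)) * z) * mFourier (-k) x).re := by
    intro x
    rw [inner_gradient_re_oneMode, sum_mul_partialDeriv_partialDeriv_re_oneMode, Complex.re_sum, mul_add,
      Finset.mul_sum]
    congr 1
    · refine Finset.sum_congr rfl fun j _ => ?_
      conv_lhs => rw [← Complex.re_ofReal_mul]
      conv_rhs => rw [real_mul_re_mul]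
      congr 1
      push_cast
      ring
    · congr 1
      rw [real_mul_re_mul]
      congr 1
      ring
  simp_rw [hpt]
  have hi : ∀ j : d, Integrable (fun x => (θ t x * u t x j) *
      ((-(2 * Real.pi * I * (k j)) * z) * mFourier (-k) x).re) volume :=
    fun j => integrable_mul_re_mul_mFourier (hju j) _ k
  rw [integral_add (integrable_finsetSum _ fun j _ => hi j) (integrable_mul_re_mul_mFourier hθt _ k),
    integral_finsetSum _ fun j _ => hi j]
  simp_rw [integral_mul_re_mul_mFourier (hju _) _ k, integral_mul_re_mul_mFourier hθt _ k]
  rw [← Complex.re_sum, ← Complex.add_re]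
  congr 1
  have hs : ∑ j, -(2 * Real.pi * I * (k j)) * z * mFourierCoeff (fun x => ((θ t x * u t x j : ℝ) : ℂ)) k =
      -(z * ∑ j, (2 * Real.pi * I * (k j)) * mFourierCoeff (fun x => ((θ t x * u t x j : ℝ) : ℂ)) k) := by
    rw [Finset.mul_sum, ← Finset.sum_neg_distrib]
    exact Finset.sum_congr rfl fun j _ => by ring
  have ec : (((4 * Real.pi ^ 2 * κ * ∑ i, a i * (k i : ℝ) ^ 2 : ℝ)) : ℂ) =
      (κ : ℂ) * ((4 * Real.pi ^ 2 * ∑ i, a i * (k i : ℝ) ^ 2 : ℝ) : ℂ) := by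
    push_cast
    ring
  rw [hs, ec]
  ring

end OneMode

/-! ## §2 The weak formulation tested with `η(t) g(x)` (solution-class API from
`PassiveScalarDiagForcedClass`) -/

section WeakTest

variable [DecidableEq d]

namespace IsWeakScalarTransportDiagForcedOn

variable {T κ : ℝ} {a : d → ℝ} {u : ℝ → UnitAddTorus d → EuclideanSpace ℝ d} {s : ℝ → UnitAddTorus d → ℝ}
  {θ₀ : UnitAddTorus d → ℝ} {θ : ℝ → UnitAddTorus d → ℝ}

/-- **The sourced diagonal weak formulation tested with `η(t) g(x)`.** For a smooth compactly
supported `η` with `tsupport η ⊆ (-∞, T)` and a smooth `g : T^d → ℝ`,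
`∫_{(0,T)} (η' ∫ θ g + η (∫ θ (⟪u, ∇g⟫ + κ ∑ᵢ aᵢ ∂ᵢ∂ᵢ g) + ∫ s g)) + η(0) ∫ θ₀ g = 0`
(private twin of the isotropic `IsWeakScalarTransportForcedOn.setIntegral_test_mul`; the public
diagonal version belongs to `PassiveScalarDiagForcedSteadyTest`). [cite: DiPernaLions1989, §II.1 (13)–(14)] -/
private theorem setIntegral_test_mul_aux (h : IsWeakScalarTransportDiagForcedOn T a κ u s θ₀ θ) {η : ℝ → ℝ}
    (hη : ContDiff ℝ ∞ η) (hηc : HasCompactSupport η) (hηT : tsupport η ⊆ Iio T)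
    {g : UnitAddTorus d → ℝ} (hg : FunctionSpaces.Torus.IsSmooth g) :
    (∫ t in Ioo 0 T, ((deriv η t * ∫ x, θ t x * g x) +
      η t * ((∫ x, θ t x * (⟪u t x, FunctionSpaces.Torus.gradient g x⟫_ℝ +
        κ * ∑ i, a i * FunctionSpaces.Torus.partialDeriv i (FunctionSpaces.Torus.partialDeriv i g) x)) +
        ∫ x, s t x * g x))) +
      η 0 * ∫ x, θ₀ x * g x = 0 := by
  have hψ := isSpaceTimeTest_mul hη hηc hηT hg
  have hg1 : FunctionSpaces.Torus.IsContDiff 1 g := hg.isContDiff (by simp)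
  have key := h.integral_prod_weak_eq hψ
  set P : Measure (ℝ × UnitAddTorus d) := ((volume : Measure ℝ).restrict (Ioo 0 T)).prod volume
    with hP
  have hpt : ∀ p : ℝ × UnitAddTorus d, θ p.1 p.2 *
      (FunctionSpaces.Torus.timeDeriv (fun t x => η t * g x) p.1 p.2 +
        ⟪u p.1 p.2, FunctionSpaces.Torus.gradient ((fun t x => η t * g x) p.1) p.2⟫_ℝ +
        κ * ∑ i, a i * FunctionSpaces.Torus.partialDeriv i
          (FunctionSpaces.Torus.partialDeriv i ((fun t x => η t * g x) p.1)) p.2) =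
      deriv η p.1 * (θ p.1 p.2 * g p.2) +
        η p.1 * (θ p.1 p.2 * (⟪u p.1 p.2, FunctionSpaces.Torus.gradient g p.2⟫_ℝ +
          κ * ∑ i, a i * FunctionSpaces.Torus.partialDeriv i (FunctionSpaces.Torus.partialDeriv i g) p.2)) := by
    intro p
    have hdiag : ∑ i, a i * FunctionSpaces.Torus.partialDeriv i
        (FunctionSpaces.Torus.partialDeriv i ((fun t x => η t * g x) p.1)) p.2 =
        η p.1 * ∑ i, a i * FunctionSpaces.Torus.partialDeriv i (FunctionSpaces.Torus.partialDeriv i g) p.2 := by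
      rw [Finset.mul_sum]
      refine Finset.sum_congr rfl fun i _ => ?_
      rw [show ((fun t x => η t * g x) p.1) = fun x => η p.1 * g x from rfl, partialDeriv_partialDeriv_const_mul]
      ring
    rw [timeDeriv_mul, gradient_const_mul hg1, real_inner_smul_right, hdiag]
    ring
  have hps : ∀ p : ℝ × UnitAddTorus d, s p.1 p.2 * (fun t x => η t * g x) p.1 p.2 =
      η p.1 * (s p.1 p.2 * g p.2) := fun p => by simp only; ring
  obtain ⟨Ca, hCa⟩ := (hη.continuous_deriv (by simp)).bounded_above_of_compact_support hηc.deriv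
  obtain ⟨Cb, hCb⟩ := hη.continuous.bounded_above_of_compact_support hηc
  set f₁ : ℝ × UnitAddTorus d → ℝ := fun p => deriv η p.1 * (θ p.1 p.2 * g p.2) with hf₁
  set f₂ : ℝ × UnitAddTorus d → ℝ := fun p =>
    η p.1 * (θ p.1 p.2 * (⟪u p.1 p.2, FunctionSpaces.Torus.gradient g p.2⟫_ℝ +
      κ * ∑ i, a i * FunctionSpaces.Torus.partialDeriv i (FunctionSpaces.Torus.partialDeriv i g) p.2)) with hf₂
  set f₃ : ℝ × UnitAddTorus d → ℝ := fun p => η p.1 * (s p.1 p.2 * g p.2) with hf₃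
  have hI₁ := h.integrable_mul_continuous hg.continuous
  have hI₂ := h.integrable_mul_steadyFlux hg
  have hI₃ := h.integrable_source_mul_continuous hg.continuous
  have hf₁i : Integrable f₁ P :=
    hI₁.bdd_mul ((hη.continuous_deriv (by simp)).comp continuous_fst).aestronglyMeasurable
      (Eventually.of_forall fun p => hCa p.1)
  have hf₂i : Integrable f₂ P :=
    hI₂.bdd_mul (hη.continuous.comp continuous_fst).aestronglyMeasurable
      (Eventually.of_forall fun p => hCb p.1)
  have hf₃i : Integrable f₃ P :=
    hI₃.bdd_mul (hη.continuous.comp continuous_fst).aestronglyMeasurable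
      (Eventually.of_forall fun p => hCb p.1)
  have esum : (∫ p, (f₁ p + f₂ p) ∂P) + (∫ p, f₃ p ∂P) + η 0 * ∫ x, θ₀ x * g x = 0 := by
    have e1 : ∫ p, (f₁ p + f₂ p) ∂P = ∫ p, θ p.1 p.2 *
        (FunctionSpaces.Torus.timeDeriv (fun t x => η t * g x) p.1 p.2 +
          ⟪u p.1 p.2, FunctionSpaces.Torus.gradient ((fun t x => η t * g x) p.1) p.2⟫_ℝ +
          κ * ∑ i, a i * FunctionSpaces.Torus.partialDeriv i
            (FunctionSpaces.Torus.partialDeriv i ((fun t x => η t * g x) p.1)) p.2) ∂P :=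
      integral_congr_ae (Eventually.of_forall fun p => (hpt p).symm)
    have e2 : η 0 * ∫ x, θ₀ x * g x = ∫ x, θ₀ x * (fun t x => η t * g x) 0 x := by
      rw [← integral_const_mul]
      exact integral_congr_ae (Eventually.of_forall fun x => by simp only; ring)
    have e3 : ∫ p, f₃ p ∂P = ∫ p, s p.1 p.2 * (fun t x => η t * g x) p.1 p.2 ∂P :=
      integral_congr_ae (Eventually.of_forall fun p => (hps p).symm)
    rw [e1, e2, e3]
    exact key
  have e₁ : ∫ p, f₁ p ∂P = ∫ t in Ioo 0 T, deriv η t * ∫ x, θ t x * g x := by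
    rw [hP, integral_prod _ hf₁i]
    refine integral_congr_ae (Eventually.of_forall fun t => ?_)
    simp only [hf₁]
    exact integral_const_mul _ _
  have e₂ : ∫ p, f₂ p ∂P = ∫ t in Ioo 0 T, η t * ∫ x, θ t x *
      (⟪u t x, FunctionSpaces.Torus.gradient g x⟫_ℝ +
        κ * ∑ i, a i * FunctionSpaces.Torus.partialDeriv i (FunctionSpaces.Torus.partialDeriv i g) x) := by
    rw [hP, integral_prod _ hf₂i]
    refine integral_congr_ae (Eventually.of_forall fun t => ?_)
    simp only [hf₂]
    exact integral_const_mul _ _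
  have e₃ : ∫ p, f₃ p ∂P = ∫ t in Ioo 0 T, η t * ∫ x, s t x * g x := by
    rw [hP, integral_prod _ hf₃i]
    refine integral_congr_ae (Eventually.of_forall fun t => ?_)
    simp only [hf₃]
    exact integral_const_mul _ _
  have ha : Integrable (fun t => deriv η t * ∫ x, θ t x * g x) (volume.restrict (Ioo 0 T)) := by
    refine hf₁i.integral_prod_left.congr (Eventually.of_forall fun t => ?_)
    simp only [hf₁]
    exact integral_const_mul _ _
  have hb : Integrable (fun t => η t * ∫ x, θ t x *
      (⟪u t x, FunctionSpaces.Torus.gradient g x⟫_ℝ +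
        κ * ∑ i, a i * FunctionSpaces.Torus.partialDeriv i (FunctionSpaces.Torus.partialDeriv i g) x))
      (volume.restrict (Ioo 0 T)) := by
    refine hf₂i.integral_prod_left.congr (Eventually.of_forall fun t => ?_)
    simp only [hf₂]
    exact integral_const_mul _ _
  have hc : Integrable (fun t => η t * ∫ x, s t x * g x) (volume.restrict (Ioo 0 T)) := by
    refine hf₃i.integral_prod_left.congr (Eventually.of_forall fun t => ?_)
    simp only [hf₃]
    exact integral_const_mul _ _
  rw [integral_add hf₁i hf₂i, e₁, e₂, e₃] at esum
  have esplit : ∀ t, (deriv η t * ∫ x, θ t x * g x) +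
      η t * ((∫ x, θ t x * (⟪u t x, FunctionSpaces.Torus.gradient g x⟫_ℝ +
        κ * ∑ i, a i * FunctionSpaces.Torus.partialDeriv i (FunctionSpaces.Torus.partialDeriv i g) x)) +
        ∫ x, s t x * g x) =
      ((deriv η t * ∫ x, θ t x * g x) +
        η t * ∫ x, θ t x * (⟪u t x, FunctionSpaces.Torus.gradient g x⟫_ℝ +
          κ * ∑ i, a i * FunctionSpaces.Torus.partialDeriv i (FunctionSpaces.Torus.partialDeriv i g) x)) +
        η t * ∫ x, s t x * g x := fun t => by ring
  have hab : Integrable (fun t => (deriv η t * ∫ x, θ t x * g x) +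
      η t * ∫ x, θ t x * (⟪u t x, FunctionSpaces.Torus.gradient g x⟫_ℝ +
        κ * ∑ i, a i * FunctionSpaces.Torus.partialDeriv i (FunctionSpaces.Torus.partialDeriv i g) x))
      (volume.restrict (Ioo 0 T)) := ha.add hb
  simp_rw [esplit]
  rw [integral_add hab hc, integral_add ha hb]
  linarith

end IsWeakScalarTransportDiagForcedOn

end WeakTest

/-! ## §3 The Fourier modes of a weak solution (diagonal diffusion, with source) -/

section ModeIdentity

variable [DecidableEq d]

namespace IsWeakScalarTransportDiagForcedOn

variable {T κ : ℝ} {a : d → ℝ} {u : ℝ → UnitAddTorus d → EuclideanSpace ℝ d} {s : ℝ → UnitAddTorus d → ℝ}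
  {θ₀ : UnitAddTorus d → ℝ} {θ : ℝ → UnitAddTorus d → ℝ}

/-- Integrability on `(0,T) × T^d` of `e_{-k}(x) θ(t,x)`. [cite: DiPernaLions1989, §II.1 (12)–(14)] -/
theorem integrable_mFourier_mul (h : IsWeakScalarTransportDiagForcedOn T a κ u s θ₀ θ) (k : d → ℤ) :
    Integrable (fun p : ℝ × UnitAddTorus d => mFourier (-k) p.2 * (θ p.1 p.2 : ℂ))
      (((volume : Measure ℝ).restrict (Ioo 0 T)).prod volume) :=
  (ofRealCLM.integrable_comp h.integrable_uncurry).bdd_mul (c := 1)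
    ((mFourier (-k)).continuous.comp continuous_snd).aestronglyMeasurable
    (Eventually.of_forall fun p => ((mFourier (-k)).norm_coe_le_norm p.2).trans_eq mFourier_norm)

/-- The Fourier modes `t ↦ 𝓕(θ(t))(k)` of a weak solution are integrable on `(0,T)`. [cite: DiPernaLions1989, §II.1 (12)–(14)] -/
theorem integrableOn_mFourierCoeff (h : IsWeakScalarTransportDiagForcedOn T a κ u s θ₀ θ) (k : d → ℤ) :
    Integrable (fun t => mFourierCoeff (fun x => (θ t x : ℂ)) k) (volume.restrict (Ioo 0 T)) := by
  have e : (fun t => mFourierCoeff (fun x => (θ t x : ℂ)) k) =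
      fun t => ∫ x, mFourier (-k) x * (θ t x : ℂ) := by
    funext t
    rw [FunctionSpaces.Torus.mFourierCoeff_eq_integral_volume]
    rfl
  rw [e]
  exact (h.integrable_mFourier_mul k).integral_prod_left

/-- Integrability on `(0,T) × T^d` of `e_{-k}(x) s(t,x)`. [cite: DiPernaLions1989, §II.1 (12)–(14)] -/
theorem integrable_mFourier_mul_source (h : IsWeakScalarTransportDiagForcedOn T a κ u s θ₀ θ) (k : d → ℤ) :
    Integrable (fun p : ℝ × UnitAddTorus d => mFourier (-k) p.2 * (s p.1 p.2 : ℂ))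
      (((volume : Measure ℝ).restrict (Ioo 0 T)).prod volume) :=
  (ofRealCLM.integrable_comp h.integrable_uncurry_source).bdd_mul (c := 1)
    ((mFourier (-k)).continuous.comp continuous_snd).aestronglyMeasurable
    (Eventually.of_forall fun p => ((mFourier (-k)).norm_coe_le_norm p.2).trans_eq mFourier_norm)

/-- The Fourier modes `t ↦ 𝓕(s(t))(k)` of the source are integrable on `(0,T)`. [cite: DiPernaLions1989, §II.1 (12)–(14)] -/
theorem integrableOn_mFourierCoeff_source (h : IsWeakScalarTransportDiagForcedOn T a κ u s θ₀ θ) (k : d → ℤ) :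
    Integrable (fun t => mFourierCoeff (fun x => (s t x : ℂ)) k) (volume.restrict (Ioo 0 T)) := by
  have e : (fun t => mFourierCoeff (fun x => (s t x : ℂ)) k) =
      fun t => ∫ x, mFourier (-k) x * (s t x : ℂ) := by
    funext t
    rw [FunctionSpaces.Torus.mFourierCoeff_eq_integral_volume]
    rfl
  rw [e]
  exact (h.integrable_mFourier_mul_source k).integral_prod_left

/-- Joint measurability of the coordinate fluxes `θ uⱼ` on `(0,T) × T^d`. [cite: DiPernaLions1989, §II.1 (12)–(14)] -/
theorem aestronglyMeasurable_mul_velocity (h : IsWeakScalarTransportDiagForcedOn T a κ u s θ₀ θ) (j : d) :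
    AEStronglyMeasurable (fun p : ℝ × UnitAddTorus d => θ p.1 p.2 * u p.1 p.2 j)
      (((volume : Measure ℝ).restrict (Ioo 0 T)).prod volume) :=
  h.aestronglyMeasurable_uncurry.mul
    ((EuclideanSpace.proj j).continuous.comp_aestronglyMeasurable h.aestronglyMeasurable_uncurry_velocity)

/-- Integrability of the coordinate fluxes `θ uⱼ` on `(0,T) × T^d` (`|θ uⱼ| ≤ ‖u‖ |θ|`). [cite: DiPernaLions1989, §II.1 (12)–(14)] -/
theorem integrable_mul_velocity (h : IsWeakScalarTransportDiagForcedOn T a κ u s θ₀ θ) (j : d) :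
    Integrable (fun p : ℝ × UnitAddTorus d => θ p.1 p.2 * u p.1 p.2 j)
      (((volume : Measure ℝ).restrict (Ioo 0 T)).prod volume) := by
  refine h.integrable_norm_velocity_mul.norm.mono' (h.aestronglyMeasurable_mul_velocity j)
    (Eventually.of_forall fun p => ?_)
  rw [norm_mul, norm_mul, norm_norm, Real.norm_eq_abs, Real.norm_eq_abs, mul_comm]
  exact mul_le_mul_of_nonneg_right (FunctionSpaces.Torus.abs_apply_le_norm (u p.1 p.2) j) (abs_nonneg _)

/-- Integrability on `(0,T) × T^d` of `e_{-k}(x) θ(t,x) uⱼ(t,x)`. [cite: DiPernaLions1989, §II.1 (12)–(14)] -/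
theorem integrable_mFourier_mul_mul_velocity (h : IsWeakScalarTransportDiagForcedOn T a κ u s θ₀ θ) (k : d → ℤ)
    (j : d) :
    Integrable (fun p : ℝ × UnitAddTorus d => mFourier (-k) p.2 * ((θ p.1 p.2 * u p.1 p.2 j : ℝ) : ℂ))
      (((volume : Measure ℝ).restrict (Ioo 0 T)).prod volume) :=
  (ofRealCLM.integrable_comp (h.integrable_mul_velocity j)).bdd_mul (c := 1)
    ((mFourier (-k)).continuous.comp continuous_snd).aestronglyMeasurable
    (Eventually.of_forall fun p => ((mFourier (-k)).norm_coe_le_norm p.2).trans_eq mFourier_norm)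

/-- The Fourier modes `t ↦ 𝓕(θ(t) uⱼ(t))(k)` of the fluxes are integrable on `(0,T)`. [cite: DiPernaLions1989, §II.1 (12)–(14)] -/
theorem integrableOn_mFourierCoeff_mul_velocity (h : IsWeakScalarTransportDiagForcedOn T a κ u s θ₀ θ)
    (k : d → ℤ) (j : d) :
    Integrable (fun t => mFourierCoeff (fun x => ((θ t x * u t x j : ℝ) : ℂ)) k)
      (volume.restrict (Ioo 0 T)) := by
  have e : (fun t => mFourierCoeff (fun x => ((θ t x * u t x j : ℝ) : ℂ)) k) =
      fun t => ∫ x, mFourier (-k) x * ((θ t x * u t x j : ℝ) : ℂ) := by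
    funext t
    rw [FunctionSpaces.Torus.mFourierCoeff_eq_integral_volume]
    rfl
  rw [e]
  exact (h.integrable_mFourier_mul_mul_velocity k j).integral_prod_left

/-- For a.e. `t ∈ (0,T)`: `θ t`, all fluxes `θ t · uⱼ t` and the source slice `s t` are integrable
on `T^d`. [cite: DiPernaLions1989, §II.1 (12)–(14)] -/
theorem ae_integrable_slice (h : IsWeakScalarTransportDiagForcedOn T a κ u s θ₀ θ) :
    ∀ᵐ t ∂(volume.restrict (Ioo 0 T)),
      Integrable (θ t) volume ∧ (∀ j, Integrable (fun x => θ t x * u t x j) volume) ∧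
        Integrable (s t) volume := by
  have hall : ∀ᵐ t ∂(volume.restrict (Ioo 0 T)), ∀ j, Integrable (fun x => θ t x * u t x j) volume :=
    ae_all_iff.2 fun j => (h.integrable_mul_velocity j).prod_right_ae
  filter_upwards [h.ae_memLp_two, hall, h.integrable_uncurry_source.prod_right_ae] with t ht hj hs
  exact ⟨ht.integrable one_le_two, hj, hs⟩

/-- Integrability on `(0,T)` of the modewise right-hand side
`-4π²κ(∑ᵢ aᵢkᵢ²) 𝓕θ(t)(k) - ∑ⱼ 2πi kⱼ 𝓕(θ uⱼ)(t)(k) + 𝓕s(t)(k)`. [cite: DiPernaLions1989, §II.1 (12)–(14)] -/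
theorem integrableOn_modeRHS (h : IsWeakScalarTransportDiagForcedOn T a κ u s θ₀ θ) (k : d → ℤ) :
    Integrable (fun τ => -(((4 * Real.pi ^ 2 * κ * ∑ i, a i * (k i : ℝ) ^ 2 : ℝ)) : ℂ) *
        mFourierCoeff (fun x => (θ τ x : ℂ)) k -
      ∑ j, (2 * Real.pi * I * (k j)) * mFourierCoeff (fun x => ((θ τ x * u τ x j : ℝ) : ℂ)) k +
      mFourierCoeff (fun x => (s τ x : ℂ)) k)
      (volume.restrict (Ioo 0 T)) :=
  (((h.integrableOn_mFourierCoeff k).const_mul _).sub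
    (integrable_finsetSum _ fun j _ => (h.integrableOn_mFourierCoeff_mul_velocity k j).const_mul _)).add
    (h.integrableOn_mFourierCoeff_source k)

/-- **The modewise integral equation, tested form.** For every `k ∈ ℤ^d` and `z ∈ ℂ`, for a.e.
`t ∈ (0,T)`,
`Re (z 𝓕θ(t)(k)) = Re (z 𝓕θ₀(k)) + ∫_{(0,t]} Re (z (-4π²κ(∑ᵢaᵢkᵢ²) 𝓕θ(τ)(k) - ∑ⱼ 2πi kⱼ 𝓕(θuⱼ)(τ)(k) + 𝓕s(τ)(k))) dτ`
(the weak formulation tested with `η(t) Re (z e_{-k}(x))`, DiPerna–Lions 1989, (14), and the a.e.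
du Bois-Reymond lemma with datum). [cite: DiPernaLions1989, §II.1 (13)–(14)] -/
theorem ae_re_mul_mFourierCoeff_eq (h : IsWeakScalarTransportDiagForcedOn T a κ u s θ₀ θ)
    (hθ₀ : Integrable θ₀ volume) (k : d → ℤ) (z : ℂ) :
    ∀ᵐ t ∂(volume.restrict (Ioo 0 T)),
      (z * mFourierCoeff (fun x => (θ t x : ℂ)) k).re =
        (z * mFourierCoeff (fun x => (θ₀ x : ℂ)) k).re +
        ∫ τ in Ioc 0 t, (z * (-(((4 * Real.pi ^ 2 * κ * ∑ i, a i * (k i : ℝ) ^ 2 : ℝ)) : ℂ) *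
            mFourierCoeff (fun x => (θ τ x : ℂ)) k -
          ∑ j, (2 * Real.pi * I * (k j)) * mFourierCoeff (fun x => ((θ τ x * u τ x j : ℝ) : ℂ)) k +
          mFourierCoeff (fun x => (s τ x : ℂ)) k)).re := by
  have hAi := h.integrableOn_mFourierCoeff k
  have hBi := h.integrableOn_modeRHS k
  refine FunctionSpaces.ae_eq_add_setIntegral_of_forall_test (hAi.const_mul z).re (hBi.const_mul z).re
    fun η hη hηc hηT => ?_
  have key := h.setIntegral_test_mul_aux hη hηc hηT (FunctionSpaces.Torus.isSmooth_re_trigPoly {-k} (fun _ => z))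
  rw [integral_mul_re_oneMode hθ₀] at key
  have hae : ∀ᵐ τ ∂(volume.restrict (Ioo 0 T)),
      (deriv η τ * ∫ x, θ τ x * (FunctionSpaces.Torus.trigPoly {-k} (fun _ => z) x).re) +
        η τ * ((∫ x, θ τ x *
          (⟪u τ x, FunctionSpaces.Torus.gradient (fun y : UnitAddTorus d => (FunctionSpaces.Torus.trigPoly {-k} (fun _ => z) y).re) x⟫_ℝ +
            κ * ∑ i, a i * FunctionSpaces.Torus.partialDeriv i (FunctionSpaces.Torus.partialDeriv i
              (fun y : UnitAddTorus d => (FunctionSpaces.Torus.trigPoly {-k} (fun _ => z) y).re)) x)) +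
          ∫ x, s τ x * (FunctionSpaces.Torus.trigPoly {-k} (fun _ => z) x).re) =
      deriv η τ * (z * mFourierCoeff (fun x => (θ τ x : ℂ)) k).re +
        η τ * (z * (-(((4 * Real.pi ^ 2 * κ * ∑ i, a i * (k i : ℝ) ^ 2 : ℝ)) : ℂ) *
            mFourierCoeff (fun x => (θ τ x : ℂ)) k -
          ∑ j, (2 * Real.pi * I * (k j)) * mFourierCoeff (fun x => ((θ τ x * u τ x j : ℝ) : ℂ)) k +
          mFourierCoeff (fun x => (s τ x : ℂ)) k)).re := by
    filter_upwards [h.ae_integrable_slice] with τ hτ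
    rw [integral_mul_re_oneMode hτ.1, integral_mul_diagFlux_oneMode hτ.1 hτ.2.1, integral_mul_re_oneMode hτ.2.2,
      ← Complex.add_re, ← mul_add]
  rw [integral_congr_ae hae] at key
  exact key

/-- **The Fourier modes of a weak solution solve the modewise ODEs in integrated form** (diagonal
diffusion, with source). For a weak solution `θ ∈ L^∞(0,T; L²(T^d))` of
`∂ₜθ + u·∇θ = κ ∑ᵢ aᵢ ∂ᵢ∂ᵢθ + s` with datum `θ₀ ∈ L¹` and every `k ∈ ℤ^d`: for a.e. `t ∈ (0,T)`,
`𝓕θ(t)(k) = 𝓕θ₀(k) + ∫_{(0,t]} (-4π²κ(∑ᵢ aᵢkᵢ²) 𝓕θ(τ)(k) - ∑ⱼ 2πi kⱼ 𝓕(θ uⱼ)(τ)(k) + 𝓕s(τ)(k)) dτ`,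
i.e. `d/dt θ̂(k) = -4π²κ(∑ᵢaᵢkᵢ²) θ̂(k) - (div (uθ))^(k) + ŝ(k)`, `θ̂(k)(0) = θ̂₀(k)` in the sense of
distributions on `[0,T)` (DiPerna–Lions 1989, (13)–(14), tested against the characters; real and
imaginary parts from `ae_re_mul_mFourierCoeff_eq` with `z = 1, i`). [cite: DiPernaLions1989, §II.1 (13)–(14)] -/
theorem ae_mFourierCoeff_eq (h : IsWeakScalarTransportDiagForcedOn T a κ u s θ₀ θ) (hθ₀ : Integrable θ₀ volume)
    (k : d → ℤ) :
    ∀ᵐ t ∂(volume.restrict (Ioo 0 T)),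
      mFourierCoeff (fun x => (θ t x : ℂ)) k = mFourierCoeff (fun x => (θ₀ x : ℂ)) k +
        ∫ τ in Ioc 0 t, (-(((4 * Real.pi ^ 2 * κ * ∑ i, a i * (k i : ℝ) ^ 2 : ℝ)) : ℂ) *
            mFourierCoeff (fun x => (θ τ x : ℂ)) k -
          ∑ j, (2 * Real.pi * I * (k j)) * mFourierCoeff (fun x => ((θ τ x * u τ x j : ℝ) : ℂ)) k +
          mFourierCoeff (fun x => (s τ x : ℂ)) k) := by
  have hBi := h.integrableOn_modeRHS k
  filter_upwards [h.ae_re_mul_mFourierCoeff_eq hθ₀ k 1, h.ae_re_mul_mFourierCoeff_eq hθ₀ k I,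
    ae_restrict_mem measurableSet_Ioo] with t h1 hI ht
  have hBt := (show IntegrableOn _ (Ioo 0 T) volume from hBi).mono_set (Ioc_subset_Ioo_right ht.2)
  simp only [one_mul] at h1
  simp only [I_mul_re] at hI
  rw [integral_neg, ← neg_add, neg_inj] at hI
  apply Complex.ext
  · rw [h1, Complex.add_re, re_integral_eq hBt]
  · rw [hI, Complex.add_im, im_integral_eq hBt]

end IsWeakScalarTransportDiagForcedOn

namespace IsWeakScalarTransportDiagOn

variable {T κ : ℝ} {a : d → ℝ} {u : ℝ → UnitAddTorus d → EuclideanSpace ℝ d}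
  {θ₀ : UnitAddTorus d → ℝ} {θ : ℝ → UnitAddTorus d → ℝ}

/-- **The modewise integral equation, homogeneous diagonal equation** (`s = 0`): for a.e. `t ∈ (0,T)`,
`𝓕θ(t)(k) = 𝓕θ₀(k) + ∫_{(0,t]} (-4π²κ(∑ᵢ aᵢkᵢ²) 𝓕θ(τ)(k) - ∑ⱼ 2πi kⱼ 𝓕(θ uⱼ)(τ)(k)) dτ`
(`isWeakScalarTransportDiagForcedOn_zero_iff` and the sourced identity; `𝓕0 = 0`).
[cite: DiPernaLions1989, §II.1 (13)–(14)] -/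
theorem ae_mFourierCoeff_eq (h : IsWeakScalarTransportDiagOn T a κ u θ₀ θ) (hθ₀ : Integrable θ₀ volume)
    (k : d → ℤ) :
    ∀ᵐ t ∂(volume.restrict (Ioo 0 T)),
      mFourierCoeff (fun x => (θ t x : ℂ)) k = mFourierCoeff (fun x => (θ₀ x : ℂ)) k +
        ∫ τ in Ioc 0 t, (-(((4 * Real.pi ^ 2 * κ * ∑ i, a i * (k i : ℝ) ^ 2 : ℝ)) : ℂ) *
            mFourierCoeff (fun x => (θ τ x : ℂ)) k -
          ∑ j, (2 * Real.pi * I * (k j)) * mFourierCoeff (fun x => ((θ τ x * u τ x j : ℝ) : ℂ)) k) := by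
  have h' : IsWeakScalarTransportDiagForcedOn T a κ u 0 θ₀ θ :=
    isWeakScalarTransportDiagForcedOn_zero_iff.2 h
  have h0 : ∀ τ : ℝ, mFourierCoeff (fun x => (((0 : ℝ → UnitAddTorus d → ℝ) τ x : ℝ) : ℂ)) k = 0 := by
    intro τ
    rw [FunctionSpaces.Torus.mFourierCoeff_eq_integral_volume]
    simp
  filter_upwards [h'.ae_mFourierCoeff_eq hθ₀ k] with t ht
  simpa only [h0, add_zero] using ht

end IsWeakScalarTransportDiagOn

end ModeIdentity

end Torus

end Literature.Analysis.FluidPDE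

end
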